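import Mathlib
import HarnessLib
import Literature.MathematicalPhysics.StatisticalMechanics.WeightedNormBounds
import Literature.MathematicalPhysics.QuantumFieldTheory.TphiSeminormTaylor

/-!
# Weighted norm bounds supply the domination hypothesis of the integration map
# (Adams–Buchholz–Kotecký–Müller, proof of Lemma 8.4: "Taylor expansion commutes with convolution")

`WeightedNormBounds.lean` proved the boundedness of the Gaussian integration map
`R K = ∫ K(· + ξ) μ(dξ)` in the weighted Taylor norms ([ABKM19] Lemma 8.4) from two hypotheses: the
integration property of the weight (Theorem 7.1 (w7)) and the LOCAL DOMINATION of the derivatives of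
the lift (`DerivDominated`, the hypothesis under which derivatives commute with the integral).  This
file discharges the second hypothesis from the weighted bound itself: if `‖K‖_{T,w} ≤ C`
(`TayNormLE T r₀ w K C`) then `‖D^p K̄(v + Tξ)‖ ≤ p!·C·w(σv + ξ)`, so it suffices that the WEIGHT is
locally (in the field, gauge-uniformly) dominated by a `μ`-integrable function of the fluctuation
field — for the Gaussian weights `e^{½(φ,Aφ)}` of [ABKM19] Ch. 7 this is the Young-type inequality
`(φ+ξ, A(φ+ξ)) ≤ t(ξ,Aξ) + t/(t−1)(φ,Aφ)` plus subcriticality with a margin (cf. the tree's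
`QuantumFieldTheory.derivDominated_shift_gaussian_of_tphiSeminorm_le`).

* `WeightDominated T w μ` — the weight-level hypothesis: for every `φ₀` there are `ε > 0` and a
  `μ`-integrable `H` with `w(φ + ξ) ≤ H(ξ)` whenever `‖T(φ − φ₀)‖ < ε`;
* **`TayNormLE.derivDominated`** — `‖K‖_{T,w} ≤ C` (`C ≥ 0`) + `WeightDominated T w μ` (+ `K` `C^{r₀}`)
  ⇒ `DerivDominated r₀ (v ξ ↦ K̄(v + Tξ)) μ`;
* **`TayNormLE.integral_comp_add'`** — Lemma 8.4 (`ℓ = 0`) with weight-level hypotheses only: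
  `‖K‖_{T,w} ≤ C`, `WeightDominated`, `∫ w(φ+ξ) μ(dξ) ≤ A w'(φ)` ⇒ `‖R K‖_{T,w'} ≤ C·A`.

Everything is proved; no named fact.

## References
* S. Adams, S. Buchholz, R. Kotecký, S. Müller, arXiv:1910.13564, Lemma 8.4 (proof)
  [AdamsBuchholzKoteckyMuller2019].
-/

noncomputable section

namespace Literature.MathematicalPhysics.StatisticalMechanics.GradientRG

open MeasureTheory Finset Metric
open Literature.MathematicalPhysics.QuantumFieldTheory

variable {E V : Type*} [NormedAddCommGroup E] [NormedSpace ℝ E] [FiniteDimensional ℝ E]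
  [NormedAddCommGroup V] [NormedSpace ℝ V]
  {𝔸 : Type*} [NormedRing 𝔸] [NormedAlgebra ℝ 𝔸]

/-- **Local domination of a weight** along the fluctuation measure `μ`: around every field `φ₀`
(locally in the GAUGE `T`) the translated weight `w(φ + ·)` is bounded by a `μ`-integrable function.
[cite: AdamsBuchholzKoteckyMuller2019, Lemma 8.4 (proof: justification of (8.9))] -/
def WeightDominated [MeasurableSpace E] (T : E →ₗ[ℝ] V) (w : E → ℝ) (μ : Measure E) : Prop :=
  ∀ φ₀ : E, ∃ ε > 0, ∃ H : E → ℝ, Integrable H μ ∧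
    ∀ ξ φ : E, ‖T (φ - φ₀)‖ < ε → w (φ + ξ) ≤ H ξ

namespace TayNormLE

variable [MeasurableSpace E] [OpensMeasurableSpace E] {T : E →ₗ[ℝ] V} {r₀ : ℕ} {w : E → ℝ}
  {K : E → 𝔸} {C : ℝ} {μ : Measure E}

/-- **A weighted norm bound dominates the derivatives of the lift** ("Taylor expansion commutes
with convolution", [ABKM19] proof of Lemma 8.4): `‖K‖_{T,w} ≤ C` (`C ≥ 0`) for a `C^{r₀}`
functional `K` and a `μ`-dominated weight give `DerivDominated r₀ (v ξ ↦ K̄(v + Tξ)) μ`.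
[cite: AdamsBuchholzKoteckyMuller2019, Lemma 8.4 (proof)] -/
theorem derivDominated (h : TayNormLE T r₀ w K C) (hC : 0 ≤ C) (hK : ContDiff ℝ r₀ K)
    (hw : WeightDominated T w μ) :
    DerivDominated r₀
      (fun (v : LinearMap.range T) (ξ : E) => gaugeLift T K (v + T.rangeRestrict ξ)) μ := by
  have hKbar : ContDiff ℝ r₀ (gaugeLift T K) := contDiff_gaugeLift T hK
  refine ⟨fun ξ => hKbar.comp (contDiff_id.add contDiff_const), fun p hp v => ?_, fun p hp v₀ => ?_⟩
  · -- measurability: `ξ ↦ D^p K̄ (v + Tξ)` is continuous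
    have hp' : (p : WithTop ℕ∞) ≤ r₀ := by exact_mod_cast hp
    have hcont : Continuous fun ξ : E => iteratedFDeriv ℝ p (gaugeLift T K) (v + T.rangeRestrict ξ) :=
      (hKbar.continuous_iteratedFDeriv hp').comp
        (continuous_const.add (gaugeRestrictCLM T).continuous)
    refine hcont.aestronglyMeasurable.congr (ae_of_all _ fun ξ => ?_)
    simp only
    rw [iteratedFDeriv_comp_add_right]
  · -- domination near `v₀`: `‖D^p K̄(v + Tξ)‖ ≤ p! ‖K‖_{T_{σv+ξ}} ≤ p! C w(σv + ξ) ≤ p! C H ξ`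
    obtain ⟨ε, hε, H, hHint, hH⟩ := hw (gaugeSection T v₀)
    refine ⟨fun ξ => (p.factorial : ℝ) * (C * |H ξ|), (hHint.abs.const_mul C).const_mul _,
      ε, hε, ae_of_all _ fun ξ v hv => ?_⟩
    rw [iteratedFDeriv_comp_add_right]
    -- identify the point: `v + Tξ = T(σ v + ξ)`
    have hpt : v + T.rangeRestrict ξ = T.rangeRestrict (gaugeSection T v + ξ) := by
      rw [map_add, rangeRestrict_gaugeSection]
    rw [hpt]
    have h1 : ‖iteratedFDeriv ℝ p (gaugeLift T K) (T.rangeRestrict (gaugeSection T v + ξ))‖ ≤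
        (p.factorial : ℝ) * tayNorm T r₀ K (gaugeSection T v + ξ) := by
      have hcoef := pow_div_factorial_mul_norm_iteratedFDeriv_le_tphiSeminorm r₀ zero_le_one
        (gaugeLift T K) (T.rangeRestrict (gaugeSection T v + ξ)) hp
      rw [one_pow, ← tayNorm_eq_tphiSeminorm] at hcoef
      have hfac : (0 : ℝ) < p.factorial := by positivity
      rw [div_mul_eq_mul_div, one_mul, div_le_iff₀ hfac] at hcoef
      linarith [hcoef]
    have h2 : tayNorm T r₀ K (gaugeSection T v + ξ) ≤ C * w (gaugeSection T v + ξ) := h _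
    have hv' : ‖T (gaugeSection T v - gaugeSection T v₀)‖ < ε := by
      have hvv : ‖v - v₀‖ < ε := by rwa [mem_ball, dist_eq_norm] at hv
      rw [map_sub, apply_gaugeSection, apply_gaugeSection, ← Submodule.coe_sub, Submodule.norm_coe]
      exact hvv
    have h3 : w (gaugeSection T v + ξ) ≤ H ξ := hH ξ _ hv'
    calc ‖iteratedFDeriv ℝ p (gaugeLift T K) (T.rangeRestrict (gaugeSection T v + ξ))‖
        ≤ (p.factorial : ℝ) * tayNorm T r₀ K (gaugeSection T v + ξ) := h1
      _ ≤ (p.factorial : ℝ) * (C * w (gaugeSection T v + ξ)) :=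
          mul_le_mul_of_nonneg_left h2 (Nat.cast_nonneg _)
      _ ≤ (p.factorial : ℝ) * (C * |H ξ|) :=
          mul_le_mul_of_nonneg_left (mul_le_mul_of_nonneg_left (h3.trans (le_abs_self _)) hC)
            (Nat.cast_nonneg _)

/-- **Lemma 8.4 (`ℓ = 0`) from weight-level hypotheses**: `‖K‖_{T,w} ≤ C` (`C ≥ 0`, `K` local and
`C^{r₀}`), the weight `w` is `μ`-dominated with `w(φ + ·)` integrable, and the INTEGRATION PROPERTY
`∫ w(φ+ξ) μ(dξ) ≤ A w'(φ)` (Theorem 7.1 (w7)) give `‖∫ K(·+ξ) μ(dξ)‖_{T,w'} ≤ C·A`.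
[cite: AdamsBuchholzKoteckyMuller2019, Lemma 8.4] -/
theorem integral_comp_add' [CompleteSpace 𝔸] {w' : E → ℝ} {A : ℝ} (h : TayNormLE T r₀ w K C)
    (hC : 0 ≤ C) (hK : ContDiff ℝ r₀ K) (hloc : IsGaugeLocal T K) (hdom : WeightDominated T w μ)
    (hwint : ∀ φ, Integrable (fun ξ => w (φ + ξ)) μ) (hw : ∀ φ, ∫ ξ, w (φ + ξ) ∂μ ≤ A * w' φ) :
    TayNormLE T r₀ w' (fun ψ => ∫ ξ, K (ψ + ξ) ∂μ) (C * A) :=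
  h.integral_comp_add hC hloc (h.derivDominated hC hK hdom) hwint hw

end TayNormLE

end Literature.MathematicalPhysics.StatisticalMechanics.GradientRG

end
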